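import Summits.AtomisticToContinuum.HydrodynamicLimit.Theorems.RelayRaceLocalityNearConstantShortTimeHLSt2SplitDefs
import Summits.AtomisticToContinuum.HydrodynamicLimit.Theorems.RelayRaceLocalityNearConstantShortTimeHLPackingBound
import HarnessLib

/-!
# Crux `NearConstantShortTimeHL` (stmt-AtomisticToContinuum-12502), line `small-tilt-domination` —
# `PositionMesoscaleLD` from the mesoscale density large deviation

Support file for the crux `…Theses.RelayRaceLocality.NearConstantShortTimeHL`, line `small-tilt-domination`:
registered helper stub `positionMesoscaleLD_of_densityLD : MesoscaleDensityLD → PositionMesoscaleLD` (the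
packing / Lipschitz-bias reduction behind the skeleton stub `stub_positionMesoscaleLD`; the density core
`MesoscaleDensityLD` of `…St2SplitDefs` is ASSUMED, not proved). With `splitFunctional R = smoothedDeviation +
crowding R`, on the support of `posGibbsMeasure` (the non-overlap set, reached a.e. since the density is an
indicator of it) and in the eventual regime `ε ≤ 2ℓ`, `13ℓ < 1/2`, `mε³ ≥ σ³/2` of an admissible family
(`pd_eventually`): the crowding fraction vanishes for `R = 2·26³/σ³` (`pd_crowding_eq_zero`, packing
`card_filter_near_le`), the ball-averaged density is `≤ 32/σ³` (`pd_ballAvg_le`), the conditional means of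
momentum / energy are within `O(Mℓρ̃)` of `ρ̃u₁`, `ρ̃e₁` for `M`-Lipschitz boxed profiles (`pd_integrand_le`), so
`smoothedDeviation ≤ 11M⁴ F_D + 16M⁴P²(1+P)ℓ²` (`pd_smoothedDeviation_le`, `P = 32/σ³`, `F_D` the density
functional); finally `∫ e^{γ n splitFunctional} ≤ e^{γKℓ²n} ∫ e^{γ_D n F_D} ≤ e^{κn}` with `γ = γ_D/(11M⁴)`.

References: H.-T. Yau, Lett. Math. Phys. 22 (1991) §2 (the reduction is folklore); volume packing (folklore).
-/

noncomputable section

namespace Summit.AtomisticToContinuum.HydrodynamicLimit.Theorems.NearConstantShortTimeHL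

open scoped BigOperators ENNReal
open MeasureTheory Set Filter Topology
open Literature.MathematicalPhysics.KineticTheory Literature.Analysis.FluidPDE Literature.Analysis.FunctionSpaces

/-! ## Elementary inequalities -/

/-- `min 1 (C a + b) ≤ C min 1 a + b` for `b ≥ 0`, `C ≥ 1`. [folklore] -/
theorem pd_min_one_le {a b C : ℝ} (hb : 0 ≤ b) (hC : 1 ≤ C) : min 1 (C * a + b) ≤ C * min 1 a + b := by
  rcases le_total 1 a with h | h
  · rw [min_eq_left h]
    exact (min_le_left _ _).trans (by linarith)
  · rw [min_eq_right h]
    exact min_le_right _ _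

/-- Bias of a nonnegatively weighted average: if every CHARGED value is `δ`-close to `u`, then
`‖m⁻¹ Σ kᵢ Uᵢ − (m⁻¹ Σ kᵢ) u‖ ≤ (m⁻¹ Σ kᵢ) δ`. [folklore] -/
theorem pd_norm_avg_sub_le {F : Type*} [SeminormedAddCommGroup F] [NormedSpace ℝ F] {m : ℕ} (k : Fin m → ℝ)
    (U : Fin m → F) (u : F) {δ : ℝ} (hk : ∀ i, 0 ≤ k i) (hU : ∀ i, k i ≠ 0 → ‖U i - u‖ ≤ δ) :
    ‖(m : ℝ)⁻¹ • ∑ i, k i • U i - ((m : ℝ)⁻¹ * ∑ i, k i) • u‖ ≤ ((m : ℝ)⁻¹ * ∑ i, k i) * δ := by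
  have hre : (m : ℝ)⁻¹ • ∑ i, k i • U i - ((m : ℝ)⁻¹ * ∑ i, k i) • u =
      (m : ℝ)⁻¹ • ∑ i, k i • (U i - u) := by
    rw [mul_smul, Finset.sum_smul, ← smul_sub, ← Finset.sum_sub_distrib]
    exact congrArg _ (Finset.sum_congr rfl fun i _ => (smul_sub _ _ _).symm)
  rw [hre, norm_smul, Real.norm_of_nonneg (inv_nonneg.2 (Nat.cast_nonneg m)), mul_assoc, Finset.sum_mul]
  refine mul_le_mul_of_nonneg_left ((norm_sum_le _ _).trans (Finset.sum_le_sum fun i _ => ?_))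
    (inv_nonneg.2 (Nat.cast_nonneg m))
  rw [norm_smul, Real.norm_of_nonneg (hk i)]
  by_cases hi : k i = 0
  · rw [hi, zero_mul, zero_mul]
  · exact mul_le_mul_of_nonneg_left (hU i hi) (hk i)

/-! ## The pointwise bias bound of the smoothed-profile integrand -/

/-- **Pointwise bias bound** (abstract weights). For nonnegative weights `kᵢ` with `ρ̃ = m⁻¹Σkᵢ`, values
`Uᵢ, Θᵢ` that are `Mℓ`-close to `u, θ` whenever `kᵢ ≠ 0`, and everything in the box `‖·‖ ≤ M`, `0 ≤ θ ≤ M`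
(`M ≥ 1`):
`(1 + ρ̃) min 1 ((ρ̃ − r)² + ‖m̄ − r u‖² + (ē − r e)²) ≤ 11M⁴ (1 + ρ̃) min 1 (ρ̃ − r)² + (1 + ρ̃) 16M⁴ρ̃²ℓ²`
(`m̄ = m⁻¹Σkᵢ Uᵢ`, `ē = m⁻¹Σkᵢ(‖Uᵢ‖²/2 + 3Θᵢ/2)`, `e = ‖u‖²/2 + 3θ/2`). [folklore] -/
theorem pd_integrand_le {m : ℕ} {k : Fin m → ℝ} (hk : ∀ i, 0 ≤ k i) {U : Fin m → V3} {Θ : Fin m → ℝ}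
    {u : V3} {θ r M ℓ : ℝ} (hM : 1 ≤ M) (hℓ : 0 ≤ ℓ) (hu : ‖u‖ ≤ M) (hθ0 : 0 ≤ θ) (hθM : θ ≤ M)
    (hU : ∀ i, ‖U i‖ ≤ M) (hnear : ∀ i, k i ≠ 0 → ‖U i - u‖ ≤ M * ℓ ∧ |Θ i - θ| ≤ M * ℓ) :
    (1 + (m : ℝ)⁻¹ * ∑ i, k i) *
        min 1 (((m : ℝ)⁻¹ * ∑ i, k i - r) ^ 2 + ‖(m : ℝ)⁻¹ • ∑ i, k i • U i - r • u‖ ^ 2 +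
          ((m : ℝ)⁻¹ * ∑ i, k i * (‖U i‖ ^ 2 / 2 + 3 / 2 * Θ i) - totalEnergyDensity r u θ) ^ 2) ≤
      11 * M ^ 4 * ((1 + (m : ℝ)⁻¹ * ∑ i, k i) * min 1 (((m : ℝ)⁻¹ * ∑ i, k i - r) ^ 2)) +
        (1 + (m : ℝ)⁻¹ * ∑ i, k i) * (16 * M ^ 4 * ((m : ℝ)⁻¹ * ∑ i, k i) ^ 2 * ℓ ^ 2) := by
  set ρt : ℝ := (m : ℝ)⁻¹ * ∑ i, k i with hρt_def
  set W : V3 := (m : ℝ)⁻¹ • ∑ i, k i • U i - r • u with hW_def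
  set Z : ℝ := (m : ℝ)⁻¹ * ∑ i, k i * (‖U i‖ ^ 2 / 2 + 3 / 2 * Θ i) - totalEnergyDensity r u θ with hZ_def
  have hρt0 : 0 ≤ ρt := mul_nonneg (inv_nonneg.2 (Nat.cast_nonneg _)) (Finset.sum_nonneg fun i _ => hk i)
  have hM0 : 0 ≤ M := zero_le_one.trans hM
  have hMℓ : 0 ≤ M * ℓ := mul_nonneg hM0 hℓ
  have hMℓ2 : M * ℓ ≤ M ^ 2 * ℓ := by nlinarith [mul_nonneg (sub_nonneg.2 hM) hMℓ]
  set e : ℝ := ‖u‖ ^ 2 / 2 + 3 / 2 * θ with he_def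
  have he0 : 0 ≤ e := by positivity
  have heM : e ≤ 2 * M ^ 2 := by
    have h1 : ‖u‖ ^ 2 ≤ M ^ 2 := pow_le_pow_left₀ (norm_nonneg _) hu 2
    have h2 : θ ≤ M ^ 2 := hθM.trans (by nlinarith)
    rw [he_def]; linarith
  -- the momentum bias
  have hmom : ‖(m : ℝ)⁻¹ • ∑ i, k i • U i - ρt • u‖ ≤ ρt * (M * ℓ) :=
    pd_norm_avg_sub_le k U u hk fun i hi => (hnear i hi).1
  -- the energy bias
  have hen : |(m : ℝ)⁻¹ * ∑ i, k i * (‖U i‖ ^ 2 / 2 + 3 / 2 * Θ i) - ρt * e| ≤ ρt * (5 / 2 * M ^ 2 * ℓ) := by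
    have h := pd_norm_avg_sub_le (δ := 5 / 2 * M ^ 2 * ℓ) k (fun i => ‖U i‖ ^ 2 / 2 + 3 / 2 * Θ i) e hk
      fun i hi => ?_
    · simpa only [smul_eq_mul, Real.norm_eq_abs] using h
    obtain ⟨h1, h2⟩ := hnear i hi
    have hn : |‖U i‖ - ‖u‖| ≤ M * ℓ := (abs_norm_sub_norm_le _ _).trans h1
    have hsq : |‖U i‖ ^ 2 - ‖u‖ ^ 2| ≤ 2 * M ^ 2 * ℓ := by
      rw [show ‖U i‖ ^ 2 - ‖u‖ ^ 2 = (‖U i‖ + ‖u‖) * (‖U i‖ - ‖u‖) by ring, abs_mul,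
        abs_of_nonneg (by positivity : 0 ≤ ‖U i‖ + ‖u‖)]
      calc (‖U i‖ + ‖u‖) * |‖U i‖ - ‖u‖| ≤ (M + M) * (M * ℓ) :=
            mul_le_mul (add_le_add (hU i) hu) hn (abs_nonneg _) (by positivity)
        _ = 2 * M ^ 2 * ℓ := by ring
    rw [Real.norm_eq_abs, show ‖U i‖ ^ 2 / 2 + 3 / 2 * Θ i - e = (‖U i‖ ^ 2 - ‖u‖ ^ 2) / 2 + 3 / 2 * (Θ i - θ) by
      rw [he_def]; ring]
    rw [abs_le] at hsq h2 ⊢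
    constructor <;> linarith [hsq.1, hsq.2, h2.1, h2.2]
  -- the two biased terms
  have hT2 : ‖W‖ ≤ ρt * (M * ℓ) + M * |ρt - r| := by
    rw [show W = ((m : ℝ)⁻¹ • ∑ i, k i • U i - ρt • u) + (ρt - r) • u by rw [hW_def, sub_smul]; abel]
    refine (norm_add_le _ _).trans (add_le_add hmom ?_)
    rw [norm_smul, Real.norm_eq_abs, mul_comm]
    exact mul_le_mul_of_nonneg_right hu (abs_nonneg _)
  have hT3 : |Z| ≤ ρt * (5 / 2 * M ^ 2 * ℓ) + 2 * M ^ 2 * |ρt - r| := by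
    rw [show Z = ((m : ℝ)⁻¹ * ∑ i, k i * (‖U i‖ ^ 2 / 2 + 3 / 2 * Θ i) - ρt * e) + (ρt - r) * e by
      simp only [hZ_def, totalEnergyDensity, he_def]; ring]
    refine (abs_add_le _ _).trans (add_le_add hen ?_)
    rw [abs_mul, abs_of_nonneg he0, mul_comm]
    exact mul_le_mul_of_nonneg_right heM (abs_nonneg _)
  -- the deviation bound
  set a : ℝ := (ρt - r) ^ 2 with ha_def
  have ha0 : 0 ≤ a := sq_nonneg _
  have habs : |ρt - r| ^ 2 = a := sq_abs _
  have hM1 : 1 ≤ M ^ 4 := one_le_pow₀ hM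
  have hM24 : M ^ 2 ≤ M ^ 4 := pow_le_pow_right₀ hM (by norm_num)
  have hc0 : 0 ≤ ρt ^ 2 * ℓ ^ 2 := by positivity
  have hD : a + ‖W‖ ^ 2 + Z ^ 2 ≤ 11 * M ^ 4 * a + 16 * M ^ 4 * ρt ^ 2 * ℓ ^ 2 := by
    have h2 : ‖W‖ ^ 2 ≤ 2 * M ^ 2 * (ρt ^ 2 * ℓ ^ 2) + 2 * M ^ 2 * a := by
      calc _ ≤ (ρt * (M * ℓ) + M * |ρt - r|) ^ 2 := pow_le_pow_left₀ (norm_nonneg _) hT2 2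
        _ ≤ 2 * (ρt * (M * ℓ)) ^ 2 + 2 * (M * |ρt - r|) ^ 2 := by
            nlinarith [sq_nonneg (ρt * (M * ℓ) - M * |ρt - r|)]
        _ = 2 * M ^ 2 * (ρt ^ 2 * ℓ ^ 2) + 2 * M ^ 2 * a := by rw [← habs]; ring
    have h3 : Z ^ 2 ≤ 25 / 2 * M ^ 4 * (ρt ^ 2 * ℓ ^ 2) + 8 * M ^ 4 * a := by
      calc _ ≤ (ρt * (5 / 2 * M ^ 2 * ℓ) + 2 * M ^ 2 * |ρt - r|) ^ 2 := by
            rw [← sq_abs Z]; exact pow_le_pow_left₀ (abs_nonneg _) hT3 2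
        _ ≤ 2 * (ρt * (5 / 2 * M ^ 2 * ℓ)) ^ 2 + 2 * (2 * M ^ 2 * |ρt - r|) ^ 2 := by
            nlinarith [sq_nonneg (ρt * (5 / 2 * M ^ 2 * ℓ) - 2 * M ^ 2 * |ρt - r|)]
        _ = 25 / 2 * M ^ 4 * (ρt ^ 2 * ℓ ^ 2) + 8 * M ^ 4 * a := by rw [← habs]; ring
    have e1 : a ≤ M ^ 4 * a := le_mul_of_one_le_left ha0 hM1
    have e2 : M ^ 2 * a ≤ M ^ 4 * a := mul_le_mul_of_nonneg_right hM24 ha0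
    have e3 : M ^ 2 * (ρt ^ 2 * ℓ ^ 2) ≤ M ^ 4 * (ρt ^ 2 * ℓ ^ 2) := mul_le_mul_of_nonneg_right hM24 hc0
    have e4 : 0 ≤ M ^ 4 * (ρt ^ 2 * ℓ ^ 2) := by positivity
    linarith
  have hmin : min 1 (a + ‖W‖ ^ 2 + Z ^ 2) ≤ 11 * M ^ 4 * min 1 a + 16 * M ^ 4 * ρt ^ 2 * ℓ ^ 2 :=
    (min_le_min le_rfl hD).trans (pd_min_one_le (by positivity) (by nlinarith))
  refine (mul_le_mul_of_nonneg_left hmin (by linarith : 0 ≤ 1 + ρt)).trans_eq ?_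
  ring

/-- The pointwise bias bound for the integrand of `smoothedDeviation` against `M`-Lipschitz boxed profiles:
the charged particles of the ball about `y` are within sup-distance `ℓ` of `y`. [folklore] -/
theorem pd_sd_integrand_le {m : ℕ} {M ℓ : ℝ} (hM : 1 ≤ M) (hℓ : 0 ≤ ℓ) {ρ₁ θ₁ : T3 → ℝ} {u₁ : T3 → V3}
    (hbox : ∀ x, 0 ≤ θ₁ x ∧ θ₁ x ≤ M ∧ ‖u₁ x‖ ≤ M)
    (hlip : ∀ x y, ‖u₁ x - u₁ y‖ ≤ M * dist x y ∧ |θ₁ x - θ₁ y| ≤ M * dist x y)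
    (x : Fin m → T3) (y : T3) :
    (1 + (m : ℝ)⁻¹ * ∑ i, ballKernel ℓ y (x i)) *
        min 1 (((m : ℝ)⁻¹ * ∑ i, ballKernel ℓ y (x i) - ρ₁ y) ^ 2 +
          ‖(m : ℝ)⁻¹ • ∑ i, ballKernel ℓ y (x i) • u₁ (x i) - ρ₁ y • u₁ y‖ ^ 2 +
          ((m : ℝ)⁻¹ * ∑ i, ballKernel ℓ y (x i) * (‖u₁ (x i)‖ ^ 2 / 2 + 3 / 2 * θ₁ (x i)) -
            totalEnergyDensity (ρ₁ y) (u₁ y) (θ₁ y)) ^ 2) ≤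
      11 * M ^ 4 * ((1 + (m : ℝ)⁻¹ * ∑ i, ballKernel ℓ y (x i)) *
          min 1 (((m : ℝ)⁻¹ * ∑ i, ballKernel ℓ y (x i) - ρ₁ y) ^ 2)) +
        (1 + (m : ℝ)⁻¹ * ∑ i, ballKernel ℓ y (x i)) *
          (16 * M ^ 4 * ((m : ℝ)⁻¹ * ∑ i, ballKernel ℓ y (x i)) ^ 2 * ℓ ^ 2) := by
  have hM0 : 0 ≤ M := zero_le_one.trans hM
  refine pd_integrand_le (k := fun i => ballKernel ℓ y (x i)) (U := fun i => u₁ (x i))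
    (Θ := fun i => θ₁ (x i)) (fun i => ballKernel_nonneg ℓ y (x i)) hM hℓ (hbox y).2.2 (hbox y).1
    (hbox y).2.1 (fun i => (hbox (x i)).2.2) fun i hi => ?_
  have hd : Torus.euclidDist y (x i) < ℓ := by
    by_contra h
    exact hi (by unfold ballKernel; rw [if_neg h])
  have hdist : dist (x i) y ≤ ℓ := by
    rw [dist_comm, dist_eq_norm]
    exact (Torus.norm_sub_le_euclidDist_holds y (x i)).trans hd.le
  exact ⟨((hlip (x i) y).1).trans (mul_le_mul_of_nonneg_left hdist hM0),
    ((hlip (x i) y).2).trans (mul_le_mul_of_nonneg_left hdist hM0)⟩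

/-! ## Packing on the support of the configurational Gibbs measure -/

/-- **Cap on the ball-averaged density of a hard-core configuration.** On the non-overlap set at exclusion
`ε ≤ 2ℓ` with `mε³ ≥ σ³/2` and `ℓ + ε/2 < 1/2`: `m⁻¹ Σᵢ ballKernel ℓ y xᵢ ≤ 32/σ³` (packing,
`card_filter_near_le`, `π ≥ 3`). [folklore] -/
theorem pd_ballAvg_le {σ : ℝ} (hσ : 0 < σ) {m : ℕ} (hm : 0 < m) {ε ℓ : ℝ} (hε : 0 < ε) (hℓ : 0 < ℓ)
    (hεℓ : ε ≤ 2 * ℓ) (hhalf : ℓ + ε / 2 < 1 / 2) (hmε : σ ^ 3 / 2 ≤ (m : ℝ) * ε ^ 3)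
    {x : Fin m → T3} (hx : x ∈ posDomain ε m) (y : T3) :
    (m : ℝ)⁻¹ * ∑ i, ballKernel ℓ y (x i) ≤ 32 / σ ^ 3 := by
  have hsum : ∑ i, ballKernel ℓ y (x i) = (4 / 3 * Real.pi * ℓ ^ 3)⁻¹ *
      ((Finset.univ.filter fun i => Torus.euclidDist y (x i) < ℓ).card : ℝ) := by
    simp only [ballKernel]
    rw [Finset.sum_ite, Finset.sum_const_zero, add_zero, Finset.sum_const, nsmul_eq_mul, mul_comm]
  have hratio : (ℓ + ε / 2) / (ε / 2) ≤ 4 * ℓ / ε := by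
    rw [div_le_div_iff₀ (by positivity) hε]; nlinarith
  have hcard : ((Finset.univ.filter fun i => Torus.euclidDist y (x i) < ℓ).card : ℝ) ≤ (4 * ℓ / ε) ^ 3 :=
    (card_filter_near_le hε hℓ hhalf x hx y).trans (pow_le_pow_left₀ (by positivity) hratio 3)
  have hm' : (0 : ℝ) < m := Nat.cast_pos.2 hm
  have hmne : (m : ℝ) ≠ 0 := hm'.ne'
  have hℓne : ℓ ≠ 0 := hℓ.ne'
  have hεne : ε ≠ 0 := hε.ne'
  rw [hsum]
  calc (m : ℝ)⁻¹ * ((4 / 3 * Real.pi * ℓ ^ 3)⁻¹ *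
        ((Finset.univ.filter fun i => Torus.euclidDist y (x i) < ℓ).card : ℝ))
      ≤ (m : ℝ)⁻¹ * ((4 / 3 * Real.pi * ℓ ^ 3)⁻¹ * (4 * ℓ / ε) ^ 3) := by gcongr
    _ = 48 / (Real.pi * ((m : ℝ) * ε ^ 3)) := by
        field_simp
        ring
    _ ≤ 48 / (Real.pi * (σ ^ 3 / 2)) :=
        div_le_div_of_nonneg_left (by norm_num) (by positivity) (mul_le_mul_of_nonneg_left hmε Real.pi_pos.le)
    _ ≤ 32 / σ ^ 3 := by
        rw [div_le_div_iff₀ (by positivity) (by positivity)]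
        nlinarith [Real.pi_gt_three, pow_pos hσ 3]

/-- **The crowding fraction vanishes on the hard-core support** for the threshold `R = 2·26³/σ³`
(`ε ≤ 2ℓ`, `13ℓ < 1/2`, `mε³ ≥ σ³/2`): every particle has at most `R · mℓ³` particles within `12ℓ`.
[folklore] -/
theorem pd_crowding_eq_zero {σ : ℝ} (hσ : 0 < σ) {m : ℕ} {ε ℓ : ℝ} (hε : 0 < ε) (hℓ : 0 < ℓ)
    (hεℓ : ε ≤ 2 * ℓ) (h13 : 13 * ℓ < 1 / 2) (hmε : σ ^ 3 / 2 ≤ (m : ℝ) * ε ^ 3)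
    {x : Fin m → T3} (hx : x ∈ posDomain ε m) :
    crowding (2 * 26 ^ 3 / σ ^ 3) ℓ x = 0 := by
  have hσ3 : 0 < σ ^ 3 := pow_pos hσ 3
  have hle : ∀ i, (nearCount (12 * ℓ) (x i) x : ℝ) ≤ 2 * 26 ^ 3 / σ ^ 3 * ((m : ℝ) * ℓ ^ 3) := by
    intro i
    unfold nearCount
    have hcard := card_filter_near_le hε (by positivity : 0 < 12 * ℓ) (by linarith) x hx (x i)
    have hratio : (12 * ℓ + ε / 2) / (ε / 2) ≤ 26 * ℓ / ε := by
      rw [div_le_div_iff₀ (by positivity) hε]; nlinarith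
    refine hcard.trans ((pow_le_pow_left₀ (by positivity) hratio 3).trans ?_)
    rw [div_pow, div_le_iff₀ (pow_pos hε 3), mul_pow,
      show 2 * 26 ^ 3 / σ ^ 3 * ((m : ℝ) * ℓ ^ 3) * ε ^ 3 =
        26 ^ 3 * ℓ ^ 3 * (2 * ((m : ℝ) * ε ^ 3) / σ ^ 3) by ring]
    refine le_mul_of_one_le_right (by positivity) ?_
    rw [one_le_div hσ3]
    linarith
  have h : ∀ i, ¬ (2 * 26 ^ 3 / σ ^ 3 * ((m : ℝ) * ℓ ^ 3) < (nearCount (12 * ℓ) (x i) x : ℝ)) :=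
    fun i => not_lt.2 (hle i)
  unfold crowding
  simp [h]

/-- **The smoothed-profile deviation is dominated by the density functional on the support**:
`smoothedDeviation ≤ 11M⁴ · ∫(1 + ρ̃) min 1 (ρ̃ − ρ₁)² + 16M⁴P²(1 + P) ℓ²`, `P = 32/σ³`. [folklore] -/
theorem pd_smoothedDeviation_le {M σ : ℝ} (hM : 1 ≤ M) (hσ : 0 < σ) {m : ℕ} (hm : 0 < m) {ε ℓ : ℝ}
    (hε : 0 < ε) (hℓ : 0 < ℓ) (hεℓ : ε ≤ 2 * ℓ) (hhalf : ℓ + ε / 2 < 1 / 2)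
    (hmε : σ ^ 3 / 2 ≤ (m : ℝ) * ε ^ 3) {ρ₁ θ₁ : T3 → ℝ} {u₁ : T3 → V3} (hρ : Measurable ρ₁)
    (hbox : ∀ x, 0 ≤ θ₁ x ∧ θ₁ x ≤ M ∧ ‖u₁ x‖ ≤ M)
    (hlip : ∀ x y, ‖u₁ x - u₁ y‖ ≤ M * dist x y ∧ |θ₁ x - θ₁ y| ≤ M * dist x y)
    {x : Fin m → T3} (hx : x ∈ posDomain ε m) :
    smoothedDeviation ℓ ρ₁ θ₁ u₁ x ≤
      11 * M ^ 4 * (∫ y, (1 + (m : ℝ)⁻¹ * ∑ i, ballKernel ℓ y (x i)) *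
          min 1 (((m : ℝ)⁻¹ * ∑ i, ballKernel ℓ y (x i) - ρ₁ y) ^ 2)) +
        16 * M ^ 4 * (32 / σ ^ 3) ^ 2 * (1 + 32 / σ ^ 3) * ℓ ^ 2 := by
  set P : ℝ := 32 / σ ^ 3 with hP_def
  set D : T3 → ℝ := fun y => (1 + (m : ℝ)⁻¹ * ∑ i, ballKernel ℓ y (x i)) *
    min 1 (((m : ℝ)⁻¹ * ∑ i, ballKernel ℓ y (x i) - ρ₁ y) ^ 2) with hD_def
  have hP0 : 0 ≤ P := by positivity
  have hρt0 : ∀ y, 0 ≤ (m : ℝ)⁻¹ * ∑ i, ballKernel ℓ y (x i) := fun y =>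
    mul_nonneg (inv_nonneg.2 (Nat.cast_nonneg _)) (Finset.sum_nonneg fun i _ => ballKernel_nonneg ℓ y (x i))
  have hρtP : ∀ y, (m : ℝ)⁻¹ * ∑ i, ballKernel ℓ y (x i) ≤ P := fun y =>
    pd_ballAvg_le hσ hm hε hℓ hεℓ hhalf hmε hx y
  have hSm : Measurable fun y : T3 => (m : ℝ)⁻¹ * ∑ i, ballKernel ℓ y (x i) :=
    (Finset.measurable_sum _ fun i _ => wg_measurable_ballKernel measurable_id measurable_const ℓ).const_mul _
  have hDm : Measurable D := (measurable_const.add hSm).mul (measurable_const.min ((hSm.sub hρ).pow_const 2))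
  have hDi : Integrable D := by
    refine (integrable_const (1 + P)).mono' hDm.aestronglyMeasurable (Eventually.of_forall fun y => ?_)
    rw [hD_def, Real.norm_of_nonneg (mul_nonneg (by linarith [hρt0 y]) (le_min zero_le_one (sq_nonneg _)))]
    calc _ ≤ (1 + (m : ℝ)⁻¹ * ∑ i, ballKernel ℓ y (x i)) * 1 :=
          mul_le_mul_of_nonneg_left (min_le_left _ _) (by linarith [hρt0 y])
      _ ≤ 1 + P := by rw [mul_one]; linarith [hρtP y]
  have hK : ∫ _y : T3, (16 * M ^ 4 * P ^ 2 * (1 + P) * ℓ ^ 2 : ℝ) = 16 * M ^ 4 * P ^ 2 * (1 + P) * ℓ ^ 2 := by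
    simp
  unfold smoothedDeviation
  calc _ ≤ ∫ y, (11 * M ^ 4 * D y + 16 * M ^ 4 * P ^ 2 * (1 + P) * ℓ ^ 2) := by
        refine integral_mono_of_nonneg (Eventually.of_forall fun y => ?_)
          ((hDi.const_mul _).add (integrable_const _)) (Eventually.of_forall fun y => ?_)
        · exact mul_nonneg (by linarith [hρt0 y]) (le_min zero_le_one (by positivity))
        · refine (pd_sd_integrand_le hM hℓ.le hbox hlip x y).trans (add_le_add_right ?_ _)
          have hsq : ((m : ℝ)⁻¹ * ∑ i, ballKernel ℓ y (x i)) ^ 2 ≤ P ^ 2 := pow_le_pow_left₀ (hρt0 y) (hρtP y) 2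
          calc (1 + (m : ℝ)⁻¹ * ∑ i, ballKernel ℓ y (x i)) *
                (16 * M ^ 4 * ((m : ℝ)⁻¹ * ∑ i, ballKernel ℓ y (x i)) ^ 2 * ℓ ^ 2)
              ≤ (1 + P) * (16 * M ^ 4 * P ^ 2 * ℓ ^ 2) :=
                mul_le_mul (by linarith [hρtP y]) (by gcongr) (by positivity) (by linarith)
            _ = 16 * M ^ 4 * P ^ 2 * (1 + P) * ℓ ^ 2 := by ring
    _ = 11 * M ^ 4 * (∫ y, D y) + 16 * M ^ 4 * P ^ 2 * (1 + P) * ℓ ^ 2 := by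
        rw [integral_add (hDi.const_mul _) (integrable_const _), integral_const_mul, hK]

/-! ## The regime of the admissible family -/

/-- **Eventual regime of an admissible family.** `n_N → ∞` and `ℓ_N = n_N^{-1/4} → 0`; eventually
`ε_N ≤ 2ℓ_N` (from `n_N ε_N⁴ = (n_N ε_N³) ε_N → 0` and `ℓ_N⁴ = 1/n_N`), `13ℓ_N < 1/2`, `n_N ε_N³ ≥ σ³/2`
and `c ℓ_N² ≤ κ/2`. [folklore] -/
theorem pd_eventually {ε : ℕ → ℝ} {n : ℕ → ℕ} {σ : ℝ} (hσ : 0 < σ) (hε : ∀ N, 0 < ε N)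
    (hε0 : Tendsto ε atTop (𝓝 0)) (hnε : Tendsto (fun N => (n N : ℝ) * ε N ^ 3) atTop (𝓝 (σ ^ 3)))
    (c : ℝ) {κ : ℝ} (hκ : 0 < κ) :
    ∀ᶠ N in atTop, 0 < n N ∧ 0 < mesoRadius (n N) ∧ ε N ≤ 2 * mesoRadius (n N) ∧
      13 * mesoRadius (n N) < 1 / 2 ∧ σ ^ 3 / 2 ≤ (n N : ℝ) * ε N ^ 3 ∧ c * mesoRadius (n N) ^ 2 ≤ κ / 2 := by
  have hn_top : Tendsto n atTop atTop := tendsto_atTop_of_tendsto_mul_pow_three hσ hε hε0 hnε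
  have hℓ : Tendsto (fun N => mesoRadius (n N)) atTop (𝓝 0) := by
    unfold mesoRadius
    exact (tendsto_rpow_neg_atTop (by norm_num : (0 : ℝ) < 1 / 4)).comp (tendsto_natCast_atTop_atTop.comp hn_top)
  have h4 : ∀ᶠ N in atTop, (n N : ℝ) * ε N ^ 3 * ε N ≤ 16 := by
    have h := hnε.mul hε0
    rw [mul_zero] at h
    exact h.eventually_le_const (by norm_num)
  have h5 : ∀ᶠ N in atTop, c * mesoRadius (n N) ^ 2 ≤ κ / 2 := by
    have h := (hℓ.pow 2).const_mul c
    rw [zero_pow two_ne_zero, mul_zero] at h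
    exact h.eventually_le_const (half_pos hκ)
  filter_upwards [hn_top.eventually_ge_atTop 1, hℓ.eventually_lt_const (by norm_num : (0 : ℝ) < 1 / 26),
    hnε.eventually_const_le (half_lt_self (pow_pos hσ 3)), h4, h5] with N h1 h2 h3 h4 h5
  have hn0 : 0 < n N := h1
  have hn0' : (0 : ℝ) < n N := Nat.cast_pos.2 hn0
  have hℓ4 : mesoRadius (n N) ^ 4 = ((n N : ℝ))⁻¹ := by
    unfold mesoRadius
    rw [← Real.rpow_natCast, ← Real.rpow_mul hn0'.le]
    norm_num
    exact Real.rpow_neg_one _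
  have hℓ0 : 0 < mesoRadius (n N) := Real.rpow_pos_of_pos hn0' _
  have hεℓ : ε N ≤ 2 * mesoRadius (n N) := by
    rw [← pow_le_pow_iff_left₀ (hε N).le (by positivity) (by norm_num : (4 : ℕ) ≠ 0), mul_pow, hℓ4,
      show (2 : ℝ) ^ 4 = 16 by norm_num, ← div_eq_mul_inv, le_div_iff₀ hn0']
    calc ε N ^ 4 * (n N : ℝ) = (n N : ℝ) * ε N ^ 3 * ε N := by ring
      _ ≤ 16 := h4
  exact ⟨hn0, hℓ0, hεℓ, by linarith, h3, h5⟩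

/-! ## The reduction -/

/-- **`PositionMesoscaleLD` from the mesoscale DENSITY large deviation** (packing + Lipschitz bias). Keep the
packing threshold `η₁` of the hypothesis; given `M, σ` and an admissible family take the crowding threshold
`R = 2·26³/σ³` and the exponent `γ = γ_D/(11M⁴)`. A.e. under `posGibbsMeasure` the configuration lies in the
non-overlap set, where (eventually in `N`: `ε_N ≤ 2ℓ_N`, `13ℓ_N < 1/2`, `n_Nε_N³ ≥ σ³/2`) the crowding fraction
vanishes and `smoothedDeviation ≤ 11M⁴ F_D + K(M,σ) ℓ_N²`; hence
`∫ exp(γ n splitFunctional) ≤ exp(γ K n ℓ_N²) ∫ exp(γ_D n F_D) ≤ exp(γ K ℓ_N² n + κn/2) ≤ exp(κ n)`.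
[cite: Yau1991, §2] -/
theorem positionMesoscaleLD_of_densityLD : MesoscaleDensityLD → PositionMesoscaleLD := by
  intro hDens
  obtain ⟨η₁, hη₁, hD⟩ := hDens
  refine ⟨η₁, hη₁, ?_⟩
  intro M hM σ hσ g ε n hε hε0 hnε
  obtain ⟨RD, γD, hγD, hD'⟩ := hD M hM σ hσ ε n hε hε0 hnε
  have hM0 : 0 < M := one_pos.trans_le hM
  have hC₁ : 0 < 11 * M ^ 4 := by positivity
  set K : ℝ := 16 * M ^ 4 * (32 / σ ^ 3) ^ 2 * (1 + 32 / σ ^ 3) with hK_def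
  refine ⟨2 * 26 ^ 3 / σ ^ 3, γD / (11 * M ^ 4), div_pos hγD hC₁, fun κ hκ => ?_⟩
  filter_upwards [hD' (κ / 2) (half_pos hκ), pd_eventually hσ hε hε0 hnε (γD / (11 * M ^ 4) * K) hκ]
    with N hDN hEN
  obtain ⟨hn0, hℓ0, hεℓ, h13, hmε, hsmall⟩ := hEN
  intro ρ₁ θ₁ u₁ hρc hθc huc hρ1 hbox hlip
  have hDx := hDN ρ₁ θ₁ u₁ hρc hθc huc hρ1 hbox hlip
  clear hDN hD'
  -- abbreviations
  set m : ℕ := n N with hm_def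
  set ℓ : ℝ := mesoRadius m with hℓ_def
  set a : T3 → ℝ := fun x => ρ₁ x * Real.exp (g (ρ₁ x)) with ha_def
  set FD : (Fin m → T3) → ℝ := fun x => ∫ y, (1 + (m : ℝ)⁻¹ * ∑ i, ballKernel ℓ y (x i)) *
    min 1 (((m : ℝ)⁻¹ * ∑ i, ballKernel ℓ y (x i) - ρ₁ y) ^ 2) with hFD_def
  have hMi : 0 < M⁻¹ := inv_pos.2 hM0
  have hbox' : ∀ x, 0 ≤ θ₁ x ∧ θ₁ x ≤ M ∧ ‖u₁ x‖ ≤ M := fun x =>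
    ⟨hMi.le.trans (hbox x).2.2.1, (hbox x).2.2.2.1, (hbox x).2.2.2.2⟩
  have hlip' : ∀ x y, ‖u₁ x - u₁ y‖ ≤ M * dist x y ∧ |θ₁ x - θ₁ y| ≤ M * dist x y := fun x y => (hlip x y).2
  have hhalf : ℓ + ε N / 2 < 1 / 2 := by linarith
  -- a.e. under the configurational Gibbs measure the spheres do not overlap
  have hae : ∀ᵐ x ∂posGibbsMeasure a (ε N) m, x ∈ posDomain (ε N) m := by
    have hind : (fun x : Fin m → T3 => ENNReal.ofReal ((posPartition a (ε N) m)⁻¹ * posWeight a (ε N) m x)) =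
        (posDomain (ε N) m).indicator fun x => ENNReal.ofReal ((posPartition a (ε N) m)⁻¹ * ∏ i, a (x i)) := by
      funext x
      by_cases hx : x ∈ posDomain (ε N) m
      · rw [Set.indicator_of_mem hx, posWeight, Set.indicator_of_mem hx]
      · rw [Set.indicator_of_notMem hx, posWeight, Set.indicator_of_notMem hx, mul_zero, ENNReal.ofReal_zero]
    rw [posGibbsMeasure, hind, withDensity_indicator (measurableSet_posDomain _ _)]
    exact (ae_restrict_mem (measurableSet_posDomain _ _)).filter_mono (withDensity_absolutelyContinuous _ _).ae_le
  -- on the support: crowding vanishes and the smoothed deviation is dominated by the density functional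
  have hpt : ∀ᵐ x ∂posGibbsMeasure a (ε N) m,
      ENNReal.ofReal (Real.exp (γD / (11 * M ^ 4) * (m : ℝ) * splitFunctional (2 * 26 ^ 3 / σ ^ 3) ℓ ρ₁ θ₁ u₁ x)) ≤
        ENNReal.ofReal (Real.exp (γD / (11 * M ^ 4) * K * ℓ ^ 2 * m)) *
          ENNReal.ofReal (Real.exp (γD * (m : ℝ) * FD x)) := by
    filter_upwards [hae] with x hx
    rw [← ENNReal.ofReal_mul (Real.exp_nonneg _), ← Real.exp_add]
    refine ENNReal.ofReal_le_ofReal (Real.exp_le_exp.2 ?_)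
    have hG : splitFunctional (2 * 26 ^ 3 / σ ^ 3) ℓ ρ₁ θ₁ u₁ x ≤ 11 * M ^ 4 * FD x + K * ℓ ^ 2 := by
      unfold splitFunctional
      rw [pd_crowding_eq_zero hσ (hε N) hℓ0 hεℓ h13 hmε hx, add_zero]
      exact pd_smoothedDeviation_le hM hσ hn0 (hε N) hℓ0 hεℓ hhalf hmε hρc.measurable hbox' hlip' hx
    refine (mul_le_mul_of_nonneg_left hG (by positivity)).trans_eq ?_
    field_simp
    ring
  have hA : γD / (11 * M ^ 4) * K * ℓ ^ 2 * m + κ / 2 * m ≤ κ * m := by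
    have := mul_le_mul_of_nonneg_right hsmall (Nat.cast_nonneg m)
    linarith
  calc _ ≤ ∫⁻ x, ENNReal.ofReal (Real.exp (γD / (11 * M ^ 4) * K * ℓ ^ 2 * m)) *
          ENNReal.ofReal (Real.exp (γD * (m : ℝ) * FD x)) ∂posGibbsMeasure a (ε N) m := lintegral_mono_ae hpt
    _ = ENNReal.ofReal (Real.exp (γD / (11 * M ^ 4) * K * ℓ ^ 2 * m)) *
          ∫⁻ x, ENNReal.ofReal (Real.exp (γD * (m : ℝ) * FD x)) ∂posGibbsMeasure a (ε N) m :=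
        lintegral_const_mul' _ _ ENNReal.ofReal_ne_top
    _ ≤ ENNReal.ofReal (Real.exp (γD / (11 * M ^ 4) * K * ℓ ^ 2 * m)) * ENNReal.ofReal (Real.exp (κ / 2 * (m : ℝ))) :=
        mul_le_mul_right hDx _
    _ = ENNReal.ofReal (Real.exp (γD / (11 * M ^ 4) * K * ℓ ^ 2 * m + κ / 2 * m)) := by
        rw [← ENNReal.ofReal_mul (Real.exp_nonneg _), ← Real.exp_add]
    _ ≤ ENNReal.ofReal (Real.exp (κ * (m : ℝ))) := ENNReal.ofReal_le_ofReal (Real.exp_le_exp.2 hA)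

end Summit.AtomisticToContinuum.HydrodynamicLimit.Theorems.NearConstantShortTimeHL

end
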